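import Summits.QuantumFields.BalabanUV.T4Continuum.Support.NE3CombGaugeCharge
import Summits.QuantumFields.BalabanUV.T4Continuum.Support.NE3CovariantBlockMean
import Summits.QuantumFields.BalabanUV.T4Continuum.Support.NE3GaugeDirFrames
import Summits.QuantumFields.BalabanUV.T4Continuum.Support.NE3BlockLineAverage
import HarnessLib

/-!
# T⁴ programme, node NE3 — row E-MLw-(w4)-P-curved, row K5b (covariant half of K5), file 1: DRESSING A FINE FIELD BY THE BLOCK-TREE
# TRANSPORT — exact transported block means, corner values, and the IN-BLOCK gauge-direction bound through the comb loop

NE3 (node U1b) formalisation swarm, leaf seat `b2b-balaban-t4-ne3-formalise-leaf-01` (gen 5); row **K5** of ruling ρ-g22-2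
(`D-ne3p1-g22-1.md` §2 S7 «covariant block-mean-exact interpolant», holder leaf-01-g5); K5a (flat) LANDED (`NE3TentBump` p227821,
`NE3BlockMeanExactInterpolant` p228188); design `HOME/b2b-balaban-t4-ne3-formalise-leaf-01/g5/K5b-DESIGN.md` (journal ≈17:12Z), file K5b-1.
Transport convention of record (r1 ∕ ρ-g22-2a): the fine tree words from the block corner, as in leaf-02-g5's `NE3CovariantBlockMean.bmeanW`.

THE OBJECT.  For ANY fine site field `F` (think: K5a's `bmeInterp` of frame-`z` data on block `z`) the DRESSED field
`dressW M W F x := Ad (btree M W (cdiv M x) x)⁻¹ (F x)` — `F x` transported from the corner frame of its block to `x` along the tree word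
`Γ_{M•z, x}` (`btree` of `AveragingDeficitBlockDensity`, = `hol W (M•z) (treeWord (x − M•z))`).  CONTENT ([folklore]; 0 sorry; one DATA def):
§1 `dressW_corner` (`= F (M•z)` on the corner lattice), `dressW_mem_skewAdjoint`, `dressW_add_period`;
§2 **`bmeanW_dressW`** — `bmeanW M W (dressW M W F) z = (M^d)⁻¹ • Σ_{v∈[0,M)^d} F (M•z + v)` EXACTLY (the transports cancel path by path:
   leaf-02-g5's `bmeanW_liftW` mechanism), so K5a's exact flat block sums become exact TRANSPORTED block means;
§3 **`gaugeDir_dressW_inblock`** — for a bond inside block `z`: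
   `gaugeDir W (dressW M W F) x μ = Ad (btree M W z (x + e_μ))⁻¹ (Ad (gaugeAct (btree M W z) W x μ)⁻¹ (F x) − F (x + e_μ))` (C0's
   `NE3CombGaugeCharge.gaugeDir_gaugeAct_eq`: the comb loop `g_{x,μ} = gaugeAct (btree M W z) W x μ` of `NE3CombGauge.hol_combLoop_eq`), and
   **`norm_gaugeDir_dressW_inblock_le`** — `‖gaugeDir W (dressW M W F) x μ‖ ≤ ‖dPot F x μ‖ + 2·(d−1)·(M−1)·a·‖F x‖` in the small-field class
   (`NE3CombGauge.norm_Ad_comb_inv_sub_le` + `l1_lowPart_le_single`): the flat coboundary plus the `(M·a)`-SIZED transport defect acting on the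
   VALUE — the in-block source of the design's `(b∕L²)²·M^{d−2}·Σ‖m‖²` data-defect cost.  (Face bonds and the coarse-frame data: K5b-2∕3.)

HONEST FRAMING.  Kinematics at ONE background; nothing about Bałaban's minimisers; (P♮)∕(ML_w) at W ≠ 1, T-E_w and **NE3 are NOT
proved**; spine PROVED 0∕9; finite T⁴ rung (B)+1 — NOT infinite volume, NOT mass gap, NOT `BetaPertH`, NOT Clay.  PLACEMENT:
`Summits/QuantumFields/BalabanUV/`.  HONEST DEPENDENCY (cell page 1): continuum YM on T⁴ ⇐ BetaPertH ∧ nine spine estimates (0/9 proved);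
BetaPertH ⇐ (D1) ∧ (D4) ∧ CAP+tail; G-an2-4 gates asym, D1 and NE2/3/4.
-/

set_option autoImplicit false

open scoped BigOperators Matrix.Norms.L2Operator
open Finset

namespace Summit.QuantumFields.BalabanUV.T4Continuum.NE3DressedBlockField

open Literature.MathematicalPhysics.QuantumFieldTheory.Balaban1983to89
open B7Prop1Explicit B7Prop2Explicit
open B8Lemma1NonAbelian (lowPart)
open T4AveragingDeficitWall (IsUnitaryCfg IsSkewDir SmallField Ad)
open T4AveragingDeficitWallBoundary (periodBox mem_periodBox IsPeriodicCfg)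
open T4AveragingDeficitNonAbelian (Ad_mul Ad_sub hol_add_period)
open AveragingDeficitTransport (Ad_mem_skewAdjoint norm_Ad_of_unitary)
open AveragingDeficitNearIdentity (Ad_one)
open AveragingDeficitBlockDensity (btree btree_mem btree_eq_axialFn)
open BlockAveragePushDirGauge (gaugeDir)
open SkeletonLattice (cdiv cmod smul_cdiv_add_cmod cmod_nonneg cmod_lt cdiv_add_period cmod_add_period cdiv_eq_of_repr)
open NE3BlockLineAverage (sum_univ_boxVec)
open NE3TangentNoGoWords (dPot)
open NE3CombGauge (btree_corner norm_Ad_comb_inv_sub_le l1_lowPart_le_single isUnitaryCfg_comb)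
open NE3CombGaugeCharge (gaugeDir_gaugeAct_eq)
open NE3CovariantBlockMean (bmeanW cdiv_cmod_block)
open NE3GaugeDirFrames (Ad_Ad_inv)

noncomputable section

variable {d : ℕ} {n : Type*} [Fintype n] [DecidableEq n]

/-! ## §1 The dressed field: corners, skewness, periodicity -/

/-- **THE DRESSED FIELD**: `F x` read through the tree transport from the corner of its block, `Ad (btree M W (cdiv M x) x)⁻¹ (F x)`. [folklore] -/
def dressW (M : ℕ) (W : Site d → Fin d → (Matrix n n ℂ)ˣ) (F : Site d → Matrix n n ℂ) (x : Site d) : Matrix n n ℂ :=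
  Ad (btree M W (cdiv M x) x)⁻¹ (F x)

/-- The block of a corner is itself (`M ≥ 1`). [folklore] -/
theorem cdiv_corner {M : ℕ} (hM : 1 ≤ M) (z : Site d) : cdiv M ((M : ℤ) • z) = z :=
  cdiv_eq_of_repr (q := 0) (by simp) (fun _ => le_rfl) (fun _ => by simp only [Pi.zero_apply]; exact_mod_cast (by omega : 0 < M))

/-- **CORNER VALUES ARE UNTOUCHED**: `dressW M W F (M•z) = F (M•z)` (`M ≥ 1`). [folklore] -/
theorem dressW_corner {M : ℕ} (hM : 1 ≤ M) (W : Site d → Fin d → (Matrix n n ℂ)ˣ) (F : Site d → Matrix n n ℂ) (z : Site d) :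
    dressW M W F ((M : ℤ) • z) = F ((M : ℤ) • z) := by
  unfold dressW
  rw [cdiv_corner hM, btree_corner, inv_one, Ad_one]

/-- The dressed field of 𝔲(n)-valued data at a unitary background is 𝔲(n)-valued. [folklore] -/
theorem dressW_mem_skewAdjoint (M : ℕ) {W : Site d → Fin d → (Matrix n n ℂ)ˣ} (hWu : IsUnitaryCfg W) {F : Site d → Matrix n n ℂ}
    (hF : ∀ x, F x ∈ skewAdjoint (Matrix n n ℂ)) (x : Site d) : dressW M W F x ∈ skewAdjoint (Matrix n n ℂ) := by
  unfold dressW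
  exact Ad_mem_skewAdjoint ((unitaryUnits _).inv_mem (btree_mem hWu M _ x)) (hF x)

/-- Periodicity: `(M·N)`-periodic `W`, `F` give an `(M·N)`-periodic dressed field (`M ≥ 1`). [folklore] -/
theorem dressW_add_period {M : ℕ} (hM : 1 ≤ M) {N : ℕ} {W : Site d → Fin d → (Matrix n n ℂ)ˣ} (hWP : IsPeriodicCfg W ((M : ℤ) * N))
    {F : Site d → Matrix n n ℂ} (hF : ∀ (x : Site d) (τ : Fin d), F (x + ((M : ℤ) * N) • e τ) = F x) (x : Site d) (τ : Fin d) :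
    dressW M W F (x + ((M : ℤ) * N) • e τ) = dressW M W F x := by
  unfold dressW
  rw [cdiv_add_period hM (N : ℤ) x τ, AveragingDeficitBlockDensity.btree_add_period M hWP, hF]

/-! ## §2 The transported block mean of a dressed field is the flat block mean of the bare field -/

/-- **`bmeanW M W (dressW M W F) z = (M^d)⁻¹ • Σ_{v∈[0,M)^d} F (M•z + v)`** — EXACT: along each tree word the dressing transport is
undone by the block-mean transport (`Ad_h (Ad_{h⁻¹} X) = X`). [folklore] -/
theorem bmeanW_dressW (M : ℕ) (W : Site d → Fin d → (Matrix n n ℂ)ˣ) (F : Site d → Matrix n n ℂ) (z : Site d) :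
    bmeanW M W (dressW M W F) z = (((M : ℝ) ^ d)⁻¹ : ℝ) • ∑ v ∈ periodBox (d := d) M, F ((M : ℤ) • z + v) := by
  unfold bmeanW
  rw [← sum_univ_boxVec M (fun v => F ((M : ℤ) • z + v)), Finset.smul_sum]
  refine Finset.sum_congr rfl fun r _ => ?_
  congr 1
  unfold dressW
  rw [(cdiv_cmod_block M z r).1, btree, add_sub_cancel_left, Ad_Ad_inv]

/-! ## §3 In-block bonds: the comb loop and the transport-defect bound -/

/-- The block of an in-block point `M•z + v`, `v ∈ [0,M)^d`. [folklore] -/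
theorem cdiv_block {M : ℕ} (z : Site d) {v : Site d} (hv : v ∈ periodBox (d := d) M) : cdiv M ((M : ℤ) • z + v) = z :=
  cdiv_eq_of_repr rfl (fun i => ((mem_periodBox).1 hv i).1) (fun i => ((mem_periodBox).1 hv i).2)

/-- **THE IN-BLOCK GAUGE DIRECTION OF A DRESSED FIELD** (both ends of the bond in block `z`): the flat difference plus the COMB LOOP acting
on the value, read in the corner frame — `gaugeDir W (dressW M W F) x μ = Ad (btree M W z (x+e_μ))⁻¹ (Ad (gaugeAct (btree M W z) W x μ)⁻¹ (F x) − F (x+e_μ))`.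
[cite: Balaban1985Averaging, (8) p.18, p.24] -/
theorem gaugeDir_dressW_inblock {M : ℕ} (W : Site d → Fin d → (Matrix n n ℂ)ˣ) (F : Site d → Matrix n n ℂ) {z x : Site d} {μ : Fin d}
    (hx : cdiv M x = z) (hx' : cdiv M (x + e μ) = z) :
    gaugeDir W (dressW M W F) x μ
      = Ad (btree M W z (x + e μ))⁻¹ (Ad (gaugeAct (btree M W z) W x μ)⁻¹ (F x) - F (x + e μ)) := by
  have h1 : gaugeDir W (dressW M W F) x μ = gaugeDir W (fun y => Ad (btree M W z y)⁻¹ (F y)) x μ := by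
    simp only [gaugeDir, dressW, hx, hx']
  have h2 := gaugeDir_gaugeAct_eq W (btree M W z) F x μ
  -- invert the outer `Ad (btree … (x + e μ))`
  have h3 : gaugeDir W (fun y => Ad (btree M W z y)⁻¹ (F y)) x μ
      = Ad (btree M W z (x + e μ))⁻¹ (gaugeDir (gaugeAct (btree M W z) W) F x μ) := by
    rw [h2, ← Ad_mul, inv_mul_cancel, Ad_one]
  rw [h1, h3]
  rfl

/-- **THE IN-BLOCK TRANSPORT-DEFECT BOUND**: `W` unitary with `SmallField W a`, `0 ≤ a`, `M ≥ 1`; for a bond `(x, μ)` with both ends in the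
block `z = cdiv M x`: `‖gaugeDir W (dressW M W F) x μ‖ ≤ ‖dPot F x μ‖ + 2·((d−1)·(M−1)·a)·‖F x‖`. [cite: Balaban1985Averaging, pp.24–25] -/
theorem norm_gaugeDir_dressW_inblock_le [Nonempty n] {M : ℕ} (hM : 1 ≤ M) {W : Site d → Fin d → (Matrix n n ℂ)ˣ} (hWu : IsUnitaryCfg W)
    {a : ℝ} (ha : 0 ≤ a) (hWa : SmallField W a) (F : Site d → Matrix n n ℂ) {x : Site d} {μ : Fin d}
    (hx' : cdiv M (x + e μ) = cdiv M x) :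
    ‖gaugeDir W (dressW M W F) x μ‖ ≤ ‖dPot F x μ‖ + 2 * (((d : ℝ) - 1) * ((M : ℝ) - 1) * a) * ‖F x‖ := by
  set z : Site d := cdiv M x with hz
  have hxlo : (M : ℤ) • z ≤ x := by
    intro i
    have h := congr_fun (smul_cdiv_add_cmod (L := M) x) i
    simp only [Pi.add_apply, Pi.smul_apply] at h
    have h0 := cmod_nonneg (L := M) hM x i
    rw [← hz] at h
    simp only [Pi.smul_apply]
    linarith
  have hxhi : x - (M : ℤ) • z ≤ fun _ => (M : ℤ) - 1 := by
    intro i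
    have h := congr_fun (smul_cdiv_add_cmod (L := M) x) i
    simp only [Pi.add_apply, Pi.smul_apply] at h
    have h1 := cmod_lt (L := M) hM x i
    rw [← hz] at h
    simp only [Pi.sub_apply, Pi.smul_apply]
    omega
  rw [gaugeDir_dressW_inblock W F hz.symm hx', norm_Ad_of_unitary ((unitaryUnits _).inv_mem (btree_mem hWu M z _))]
  have hsplit : Ad (gaugeAct (btree M W z) W x μ)⁻¹ (F x) - F (x + e μ)
      = (Ad (gaugeAct (btree M W z) W x μ)⁻¹ (F x) - F x) - dPot F x μ := by
    simp only [dPot]; abel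
  rw [hsplit]
  refine (norm_sub_le _ _).trans ?_
  rw [add_comm]
  refine add_le_add le_rfl ?_
  refine (norm_Ad_comb_inv_sub_le hWu hWa z hxlo μ (F x)).trans ?_
  have hl1 := l1_lowPart_le_single (M := M) μ (sub_nonneg.mpr hxlo) hxhi
  have h1 : (l1 (lowPart μ (x - (M : ℤ) • z)) : ℝ) * a ≤ ((d : ℝ) - 1) * ((M : ℝ) - 1) * a :=
    mul_le_mul_of_nonneg_right hl1 ha
  exact mul_le_mul_of_nonneg_right (mul_le_mul_of_nonneg_left h1 (by norm_num)) (norm_nonneg (F x))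

end

end Summit.QuantumFields.BalabanUV.T4Continuum.NE3DressedBlockField
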